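import Summits.RiemannHypothesis.RiemannHypothesis.Theorems.TiltedLandingLaw421R3MenuThinBox
import Summits.RiemannHypothesis.RiemannHypothesis.Theorems.TiltedLandingLaw421R3ARemBox
import Summits.RiemannHypothesis.RiemannHypothesis.Theorems.TiltedLandingLaw421R3FlatMenuBBDoors

/-!
# W-09 · C4 «kernel desk» (rh-idea-6 g46) — token 179 «MenuThinE5»: the E5 leaf assembled (image v1)

SUPPORT toward crux ⟨stmt-RiemannHypothesis-27010⟩ `…EarlyAppointments.TiltedLandingLaw421RT` (helper; not a stub, not the crux).
Assembles the E5 leaf `RhW08.MenuThinNF.MenuThinCertFormSig (√5/2) (27/256)` (#1311 :270) BY NAME from: the doors #1323 «MenuThinTop»,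
the leaf form #1324 «MenuThinLeaf» (`ReducedLeaf3Sig`, `reducedLeaf3_of_uniform`), the T-box `G ≥ 9/25` + PH glue «MenuThinBox» (173;
`gBox_925`, `reducedLeaf3_of_PH`), C3 g59's A-box `J ≤ 9/2` «ARemBox» (174; `RhW08.ARemBox.jBound_92`), and C1 g42's kernel-certified flat
trichotomy «FlatMenuBBDoors» (178, over M1–M3 = 175–177; `RhW08.FlatMenuBB.flatDoors_92_1_925` = `FlatDoors3Sig (9/2) 1 (9/25)` pointwise).
Output: `menuThinCertFormSig_holds`, and stubs 2a/2b's input `certificatesExistThinSig_holds : RhW08.SinkThin.CertificatesExistThinSig (√5/2)`.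
Nothing in this file bears on the truth of RH; ⟨27010⟩ stays OPEN; this discharges one named INPUT of the sink line, not the crux.
-/

noncomputable section

namespace RhW08.MenuThinE5

open RhW08.SinkBdry RhW08.SinkConePos RhW08.MenuThin RhW08.MenuThinNF RhW08.MenuThinTop RhW08.MenuThinLeaf RhW08.MenuThinBox

/-- the J-half BY NAME: C3's `RhW08.ARemBox.jBound_92` IS `BoxSig (JBoundOn (9/2))` — `BoxSig`, `JBoundOn`, `OnThinBdry` unfold by `rfl`. -/
theorem jBox_92 : BoxSig (JBoundOn (9 / 2)) := RhW08.ARemBox.jBound_92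

/-- both box lemmas of the PH triple (`J ≤ 9/2` from «ARemBox», `G ≥ 9/25` from «MenuThinBox»). -/
theorem uniformBoxes_92_925 : UniformBoxesSig (9 / 2) (9 / 25) := uniformBoxes_PH_of_J jBox_92

/-- the flat half BY NAME: C1's kernel-certified `RhW08.FlatMenuBB.flatDoors_92_1_925` («FlatMenuBBDoors», stated pointwise over #1323's names)
IS `FlatDoors3Sig (9/2) 1 (9/25)` (#1324 :71) — the def unfolds by `rfl`. -/
theorem flatDoors3_92_1_925 : FlatDoors3Sig (9 / 2) 1 (9 / 25) := RhW08.FlatMenuBB.flatDoors_92_1_925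

/-- ★★★ THE REDUCED LEAF `ReducedLeaf3Sig` (#1324 «MenuThinLeaf» :26) from the two box lemmas and C1's kernel-certified flat trichotomy. -/
theorem reducedLeaf3Sig_holds : ReducedLeaf3Sig := reducedLeaf3_of_PH jBox_92 flatDoors3_92_1_925

/-- ★★★ THE E5 LEAF: `MenuThinCertFormSig (√5/2) (27/256)` (#1311 «MenuThinNF» :270) — for every legal NF datum one of the four thin read certificates
dominates on the thin boundary. -/
theorem menuThinCertFormSig_holds : MenuThinCertFormSig (Real.sqrt 5 / 2) (27 / 256) := menuThinCertFormSig_of_reduced3 _ reducedLeaf3Sig_holds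

/-- ★★★ THE SINK-CERTIFICATE INPUT of stubs 2a/2b: `RhW08.SinkThin.CertificatesExistThinSig (√5/2)` (#1315 «MenuThinEdge»'s hypothesis discharged). -/
theorem certificatesExistThinSig_holds : RhW08.SinkThin.CertificatesExistThinSig (Real.sqrt 5 / 2) :=
  certificatesExistThinSig_of_PH jBox_92 flatDoors3_92_1_925

end RhW08.MenuThinE5

end
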